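import Mathlib
import HarnessLib
import Summits.Ventures.CertifiedManyBodySolver.Theses.M3x2EdgeSplit
import Literature.MathematicalPhysics.QuantumLattice.HubbardNNNHoppingWindowCertificateD4
import Literature.Analysis.Convex.MatrixStarAlgebraPSD

/-!
# Line `replayable_clique_blocks` — CRUX-PLAN skeleton for the crux `LowerEdge_ge_m83o100`
(stmt-Ventures-22024, route `M3x2EdgeSplit`; team lb-chord, seat hub-lb-chord-plan-1 g0, 2026-08-28)

Crux (verbatim): `∃ lo : ℚ, -83/100 ≤ lo ∧ M3EnergyLowerRow 0 lo` — SOME certified thermodynamic-limit lower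
row `lo ≤ e₀(U = 8, n = 7/8, t' = 0)` with `lo ≥ −0.83`. Met BY VALUE today by CERTIFIED #529 (MENU-core «E₁»,
−0.8295699476, margin 4.3e-4), a 2.3 M-variable first-order dual certificate whose Lean presence is a CLAIM
NODE (Tier C: PSD of its blocks and the operator identity are hypotheses, not kernel facts).

PARENT CLASS. The sibling line `Cruxes/LowerEdge_ge_m4o5/Lines/clique_sparse_sos.lean` (hub-lb-chord-plan-2,
registered on stmt-21721 AND stmt-22024) types the class every lb-chord cover instantiates —
`CliqueCertBound q`: the D4-window SOS identity at `(1, 0, 8, 7/8)` with a finite SUM of clique Gram forms, ONE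
PSD HYPOTHESIS `(Λb k).PosSemidef` per clique — and proves it exactly as strong as the dense class. THIS line
is the layer BELOW it, where chordal sparsity actually pays in Lean: the PSD hypotheses are replaced by DATA
THE KERNEL CAN RE-RUN. A clique block is a RATIONAL matrix `S k : Matrix (Fin (d k)) (Fin (d k)) ℚ` of
dimension `d k ≤ N` together with the Boolean fact `psdCheck (d k) (S k) = true`, where `psdCheck` is the
exact LDLᵀ test defined below (computable; `decide +kernel` evaluates it — see the `example`). The cost of
replaying the PSD side of a certificate is then `Σ_k d_k³` rational operations instead of `n³`: block
dimension, not program size, is the price — which is the lb-chord lever stated as a Lean object. Dictionary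
to the parent class: `ι := Fin K`, `d k := Fin (d k)`, `Λb k := (S k).map (ℚ → ℂ)`, `(Λb k).PosSemidef` from
STUB P; the rest of the identity is verbatim (packaged here as `WinData` to keep the theorem's association).

NUMBERS OF RECORD that shape STUB W (team bus, by value): #529 margin over −0.83 = 4.3e-4; crit-2 bars
USEFUL Δv ≤ 3e-4 at ≤ ¼ memory / DEAD > 1e-3; chord-E1 F0 (eng-1 RESULT 1, 05:59:30Z): every cover that
splits column classes of a CORE component is DEAD (v0′ gentlest cover Δv = +8.9e-3; M2a arm split +4.0e-3),
dual-guided heavy family undecided; MENU E₁'s two largest blocks have n = 1 253 (25 CORE + 1 228 ARM columns).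
Hence W is NOT expected from a cover of E₁ itself; its realistic instances are (i) a dual-guided heavy cover
if it passes F1, or (ii) a LARGER host (CAP(4,4)-class dense value ≈ −0.80) covered lossily (a 1e-2 loss still
clears −0.83) — W quantifies over all window data, not over covers of one program.

Registered stubs (exactly two; `sorry` occurs only inside them):
* `stub_psdCheck_sound` (P, L-sized, TRUE — verified computation): the exact rational LDLᵀ test
  `psdCheck` (first-index pivoting; a zero pivot demands a zero row/column) is SOUND: a rational block that
  passes it is positive semidefinite over `ℂ`. This is the kernel-replay primitive for the PSD side of a
  certificate, cubic in the BLOCK dimension — precisely the cost that chordal / clique sparsity cuts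
  (`Σ_k d_k³` instead of `n³`); it is where the lb-chord lever lives in Lean.
* `stub_replayableBlocks626_m83o100` (W, XL, NUMERICAL — the load-bearing stub): a clique-sparse packaged
  window certificate at the M3 cell whose rational clique blocks all PASS `psdCheck`, every block of
  dimension ≤ 626 (svec(626)/svec(1 253) = 0.2498 ≤ ¼ of the svec of MENU's largest block), with value
  ≥ −83/100, EXISTS. Produced outside Lean (cover → FO/IPM re-solve → l1cert exact recert → the cell's
  su2avg / Ward-free dictionary to the window form); closable in the tree by exhibiting the data (then P makes
  the PSD side a kernel computation) or, as every row of record today, by a claim node. Why it might fail: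
  every block-≤-626 certificate reachable by the team's engines loses more than its host's margin over −0.83
  (E₁: 4.3e-4, already exceeded by every class-splitting cover measured; larger hosts: margin ≈ 1e-2 … 3e-2 but
  no dated certified object) — then the lead re-registers the bound upward (N = 1 253 is met by E₁'s own
  blocks once E₁ is exactly re-certified in window form) or the line parks.
Proved here (no sorry): `cliqueGram_eq_blockDiagonal` (G: the clique-sum Gram element IS the Gram form of
the block-diagonal lift `blockDiagonal' S` — the l1cert lift `G = Σ_k V_k S_k V_kᵀ` in operator form, the
typed content of "clique sparsity is free for soundness"), `CliqueGram.lift_posSemidef` (blockwise PSD ⇒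
lift PSD, via the in-tree `posSemidef_blockDiagonal'_iff`, Horn–Johnson 7.1.P6) and `windowBound_M3`
(T: the in-tree window theorem instantiated at `(1, 0, 8, 7/8)` for packaged data).

Composition `LowerEdge_ge_m83o100_of` (from the two stubs; hypothesis form `lowerEdge_m83o100_of_P_W : P → W → crux-unfolded`, sorry-free; head = the crux BY NAME): W's blocks
pass `psdCheck`, so by P they are PSD, so the lift is PSD, so by G the certificate is a window certificate
with a PSD Gram matrix, so by T `−83/100 ≤ value ≤ e₀(8, 7/8, 0)`.

Disproof used: none on record (no `Cruxes/LowerEdge_ge_m83o100/Disproof.lean`; negatives index of the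
summit has no statement about sparse / block-bounded certificates). Dead lines avoided: none registered on
this crux (first `Lines/` entry). HONEST FRAMING: a relaxation of a relaxation never raises a bound; no
summit statement is proved here; a certified bound is a number with a certificate; nothing here predicts
superconductivity.
-/

namespace Summit.Ventures.CertifiedManyBodySolver.Cruxes.LowerEdge_ge_m83o100.ReplayableCliqueBlocks

/-! ## The replay primitive: exact rational LDLᵀ positive-semidefiniteness test -/

/-- Exact rational LDLᵀ test for positive semidefiniteness, pivoting on the first index: the first row
must equal the first column; a negative pivot fails; a zero pivot requires a zero first row (hence column)
and recurses on the minor; a positive pivot recurses on the Schur complement. Cubic in `d`. COMPUTABLE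
(kernel / `native_decide` replay per clique block). -/
def psdCheck : (d : ℕ) → Matrix (Fin d) (Fin d) ℚ → Bool
  | 0, _ => true
  | d + 1, S =>
    decide (∀ i : Fin (d + 1), S 0 i = S i 0) &&
      (if S 0 0 < 0 then false
       else if S 0 0 = 0 then
         decide (∀ i : Fin (d + 1), S 0 i = 0) && psdCheck d (fun i j => S i.succ j.succ)
       else psdCheck d (fun i j => S i.succ j.succ - S i.succ 0 * S 0 j.succ / S 0 0))

/-- Sanity replay: `[[2, 1], [1, 2]]` passes, `[[1, 2], [2, 1]]` (indefinite) fails, the singular PSD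
`[[1, 1], [1, 1]]` passes, `[[0, 1], [1, 0]]` (zero pivot, nonzero row) fails. -/
example : psdCheck 2 !![2, 1; 1, 2] = true ∧ psdCheck 2 !![1, 2; 2, 1] = false ∧
    psdCheck 2 !![1, 1; 1, 1] = true ∧ psdCheck 2 !![0, 1; 1, 0] = false := by decide +kernel

noncomputable section

open Matrix Finset
open Literature.MathematicalPhysics.QuantumLattice
open Literature.MathematicalPhysics.QuantumLattice.HubbardWave0
open Literature.MathematicalPhysics.QuantumLattice.ThermodynamicLimit
open Literature.MathematicalPhysics.QuantumManyBody.StateRelaxation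
open Literature.Probability.LatticeModels
open scoped ComplexOrder BigOperators

/-! ## Packaged window data (everything of `energyDensityTT'_ge_of_window_certificate_d4` except the Gram term; `rest₁`/`rest₂` keep the theorem's association) -/

/-- The NON-Gram data of a D4-window certificate on an inner region `Λ` inside a frame `Λ'`, with all index
sets finite types `Fin _` (EOM words `B`, affine-`D₄` identification words `Y`, charged words `cw`,
anti-Hermitian parts `V`, slack words `word` with coefficients `a`, chemical potentials `μ`, constant `c`). -/
structure WinData (Λ Λ' : Finset (Site 2)) where
  hΛ : Λ ⊆ Λ'
  h8 : thicken Λ 1 ⊆ Λ'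
  h0 : thicken ({0} : Finset (Site 2)) 1 ⊆ Λ'
  hz : (0 : Site 2) ∈ Λ'
  μ : Fin 2 → ℝ
  nB : ℕ
  B : Fin nB → FermionOp Λ
  nY : ℕ
  γ : Fin nY → DihedralGroup 4
  wv : Fin nY → Site 2
  hsh : ∀ l, d4ShiftSet (γ l) (wv l) Λ ⊆ Λ'
  Y : Fin nY → FermionOp Λ
  nC : ℕ
  b : Fin nC → ℂ
  cw : Fin nC → List (Orb (PolySite Λ') × Bool)
  hcw : ∀ j, ladderCharge (cw j) ≠ 0 ∨ ladderSpinCharge (cw j) ≠ 0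
  nV : ℕ
  dc : Fin nV → ℝ
  V : Fin nV → FermionOp Λ'
  nW : ℕ
  a : Fin nW → ℂ
  word : Fin nW → List (Orb (PolySite Λ') × Bool)
  c : ℝ

namespace WinData

variable {Λ Λ' : Finset (Site 2)} (D : WinData Λ Λ')

/-- Left-hand side of the window identity at the M3 cell `(t, t', U, n) = (1, 0, 8, 7/8)`:
`Γ(incl) E_Φ − c·1 − Σ_σ μ_σ (n_{0σ} − (7/16)·1)`. -/
def lhs : FermionOp Λ' :=
  fermionEmbed (PolySite.incl D.h0) ((hubbardTTPrimeFermionInteraction 1 0 8).meanEnergyObs 1) -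
    (D.c : ℂ) • (1 : FermionOp Λ') -
    ∑ σ : Fin 2, ((D.μ σ : ℝ) : ℂ) • (nAt 0 D.hz σ - (((7 / 8 : ℝ) / 2 : ℝ) : ℂ) • (1 : FermionOp Λ'))

/-- The non-Gram right-hand-side terms that vanish IN EXPECTATION in the relevant states (EOM
commutators, affine-`D₄` differences, charged words) — the first parenthesised group of the theorem. -/
def rest₁ : FermionOp Λ' :=
  ∑ k ∈ (univ : Finset (Fin D.nB)),
      ((hubbardTTPrimeFermionInteraction 1 0 8).localHamiltonian Λ' * fermionEmbed (PolySite.incl D.hΛ) (D.B k) -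
        fermionEmbed (PolySite.incl D.hΛ) (D.B k) * (hubbardTTPrimeFermionInteraction 1 0 8).localHamiltonian Λ') +
    ∑ l ∈ (univ : Finset (Fin D.nY)),
      (fermionEmbed (PolySite.incl (D.hsh l)) (fermionEmbed (PolySite.d4Emb (D.γ l) (D.wv l) Λ) (D.Y l)) -
        fermionEmbed (PolySite.incl D.hΛ) (D.Y l)) +
    ∑ j ∈ (univ : Finset (Fin D.nC)), D.b j • ladderWord (D.cw j)

/-- The right-hand-side terms bounded by REAL-PART / NORM arguments (anti-Hermitian parts, slack words with
penalty `Σ‖a_k‖`) — the second parenthesised group of the theorem. -/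
def rest₂ : FermionOp Λ' :=
  ∑ m' ∈ (univ : Finset (Fin D.nV)), ((D.dc m' : ℝ) : ℂ) • ((D.V m')ᴴ - D.V m') +
    ∑ k ∈ (univ : Finset (Fin D.nW)), D.a k • ladderWord (D.word k)

/-- The certified value `c − Σ_k ‖a_k‖`. -/
def value : ℝ := D.c - ∑ k ∈ (univ : Finset (Fin D.nW)), ‖D.a k‖

end WinData

/-! ## Clique-sparse Gram data (the lb-chord object) -/

/-- A CLIQUE-SPARSE Gram certificate over one word basis `O : Fin n → 𝔄_{Λ'}`: `K` cliques, clique `k`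
of size `d k ≤ N` embedded into the basis by `emb k`, with a RATIONAL block `S k` on it that PASSES the
exact test `psdCheck` (overlaps allowed — this is chordal/clique sparsity, not a block-diagonal basis split;
the data is replay-shaped: the kernel can re-run `psdCheck` per block). -/
structure CliqueGram (Λ' : Finset (Site 2)) (N : ℕ) where
  n : ℕ
  O : Fin n → FermionOp Λ'
  K : ℕ
  d : Fin K → ℕ
  hd : ∀ k, d k ≤ N
  emb : (k : Fin K) → Fin (d k) → Fin n
  S : (k : Fin K) → Matrix (Fin (d k)) (Fin (d k)) ℚ
  hcheck : ∀ k, psdCheck (d k) (S k) = true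

namespace CliqueGram

variable {Λ' : Finset (Site 2)} {N : ℕ} (G : CliqueGram Λ' N)

/-- The clique blocks as complex matrices. -/
def Sc (k : Fin G.K) : Matrix (Fin (G.d k)) (Fin (G.d k)) ℂ := (G.S k).map ((↑) : ℚ → ℂ)

/-- The clique-sum Gram element `Σ_k Σ_{i,j} (S_k)_{ij} • (O_{emb k i})† O_{emb k j}`. -/
def gram : FermionOp Λ' := ∑ k : Fin G.K, gramForm (G.Sc k) (fun i => G.O (G.emb k i))

/-- The block-diagonal LIFT of the clique blocks over the disjoint union of the cliques
(the l1cert lift `G = Σ_k V_k S_k V_kᵀ`). -/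
def lift : Matrix (Σ k : Fin G.K, Fin (G.d k)) (Σ k : Fin G.K, Fin (G.d k)) ℂ := blockDiagonal' G.Sc

/-- The lifted (repeated) word family over the disjoint union of the cliques. -/
def Ohat : (Σ k : Fin G.K, Fin (G.d k)) → FermionOp Λ' := fun x => G.O (G.emb x.1 x.2)

/-- Blockwise PSD ⇒ the lift is PSD (Horn–Johnson 7.1.P6, in tree as `posSemidef_blockDiagonal'_iff`). -/
theorem lift_posSemidef (hS : ∀ k, (G.Sc k).PosSemidef) : G.lift.PosSemidef :=
  (Literature.Analysis.Convex.MatrixStarAlgebra.posSemidef_blockDiagonal'_iff G.Sc).2 hS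

/-- G (proved): the clique-sum Gram element is the Gram form of the block-diagonal lift — clique sparsity
costs nothing on the soundness side. -/
theorem cliqueGram_eq_blockDiagonal : G.gram = gramForm G.lift G.Ohat := by
  classical
  simp only [CliqueGram.gram, CliqueGram.lift, CliqueGram.Ohat, gramForm]
  rw [Fintype.sum_sigma]
  refine Finset.sum_congr rfl fun k _ => ?_
  refine Finset.sum_congr rfl fun i _ => ?_
  rw [Fintype.sum_sigma]
  rw [Finset.sum_eq_single k]
  · refine Finset.sum_congr rfl fun j _ => ?_
    rw [Matrix.blockDiagonal'_apply_eq]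
  · intro k' _ hk'
    apply Finset.sum_eq_zero
    intro j _
    rw [Matrix.blockDiagonal'_apply_ne _ _ _ (Ne.symm hk')]
    simp
  · intro h; exact absurd (Finset.mem_univ k) h

end CliqueGram

/-- `C⁺(N, q)`: a clique-sparse D4-window certificate at the M3 cell, with rational clique blocks of
dimension `≤ N` that pass `psdCheck`, and certified value `≥ q`, EXISTS. -/
def SparseWindowCert (N : ℕ) (q : ℝ) : Prop :=
  ∃ (Λ Λ' : Finset (Site 2)) (D : WinData Λ Λ') (G : CliqueGram Λ' N),
    D.lhs = G.gram + D.rest₁ + D.rest₂ ∧ q ≤ D.value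

/-! ## T (proved): the window theorem at the M3 cell for packaged data -/

/-- T (proved): a packaged D4-window certificate with ANY PSD Gram matrix bounds the thermodynamic-limit
energy density `e₀(U = 8, n = 7/8, t' = 0)` from below by its value (direct instance of the in-tree
`energyDensityTT'_ge_of_window_certificate_d4`). -/
theorem windowBound_M3 {Λ Λ' : Finset (Site 2)} (D : WinData Λ Λ')
    {m : Type} [Fintype m] [DecidableEq m] {Λm : Matrix m m ℂ} (hΛm : Λm.PosSemidef)
    (O : m → FermionOp Λ') (hcert : D.lhs = gramForm Λm O + D.rest₁ + D.rest₂) :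
    D.value ≤ energyDensityTT' 1 0 8 (7 / 8) := by
  have h := energyDensityTT'_ge_of_window_certificate_d4 1 0 (U := 8) (by norm_num) (n := 7 / 8)
    (by norm_num) (by norm_num) D.hΛ D.h8 D.h0 D.hz D.μ hΛm O univ D.B univ D.γ D.wv D.hsh D.Y univ D.b
    D.cw (fun j _ => D.hcw j) univ D.dc D.V univ D.a D.word (c := D.c)
    (by unfold WinData.lhs WinData.rest₁ WinData.rest₂ at hcert; exact hcert)
  unfold WinData.value
  exact h

/-! ## The two registered stubs -/

/-- STUB P (L, TRUE — verified computation): soundness of the exact rational LDLᵀ test. Induction on `d`: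
reindex `Fin (d+1)` as `Fin 1 ⊕ Fin d`, positive pivot ⇒ Schur complement
(`Matrix.PosSemidef.fromBlocks₁₁`), zero pivot ⇒ zero row/column and the minor, casts `ℚ → ℂ`. -/
theorem stub_psdCheck_sound {d : ℕ} (S : Matrix (Fin d) (Fin d) ℚ) (h : psdCheck d S = true) :
    (S.map ((↑) : ℚ → ℂ)).PosSemidef := by
  sorry

/-- STUB W (XL, numerical; load-bearing): a clique-sparse window certificate at the M3 cell with rational
clique blocks of dimension ≤ 626 passing `psdCheck` and value ≥ −83/100 exists (a USEFUL cover of a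
MENU-class program in the sense of the team's sealed bar, FO-re-solved and exactly re-certified). -/
theorem stub_replayableBlocks626_m83o100 : SparseWindowCert 626 (((-83 / 100 : ℚ) : ℝ)) := by
  sorry

/-! ## Composition -/

/-- Any clique-sparse certificate of value `q` bounds `e₀` by `q`, GIVEN the soundness of `psdCheck`
(sorry-free apart from its explicit hypothesis; the data path for clique-form certificates). -/
theorem energy_ge_of_sparseWindowCert
    (hP : ∀ {d : ℕ} (S : Matrix (Fin d) (Fin d) ℚ), psdCheck d S = true → (S.map ((↑) : ℚ → ℂ)).PosSemidef)
    {N : ℕ} {q : ℝ} (hW : SparseWindowCert N q) : q ≤ energyDensityTT' 1 0 8 (7 / 8) := by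
  obtain ⟨Λ, Λ', D, G, hcert, hq⟩ := hW
  have hS : ∀ k, (G.Sc k).PosSemidef := fun k => hP (G.S k) (G.hcheck k)
  have hcert' : D.lhs = gramForm G.lift G.Ohat + D.rest₁ + D.rest₂ := by
    rw [← G.cliqueGram_eq_blockDiagonal]; exact hcert
  exact le_trans hq (windowBound_M3 D (G.lift_posSemidef hS) G.Ohat hcert')

/-- Hypothesis form (sorry-free): soundness of `psdCheck` and a replayable block-≤-626 certificate of value
≥ −83/100 give the crux's statement (unfolded). -/
theorem lowerEdge_m83o100_of_P_W
    (hP : ∀ {d : ℕ} (S : Matrix (Fin d) (Fin d) ℚ), psdCheck d S = true → (S.map ((↑) : ℚ → ℂ)).PosSemidef)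
    (hW : SparseWindowCert 626 (((-83 / 100 : ℚ) : ℝ))) :
    ∃ lo : ℚ, (-83 / 100 : ℚ) ≤ lo ∧ Summit.Ventures.CertifiedManyBodySolver.M3EnergyLowerRow 0 lo :=
  ⟨-83 / 100, le_rfl, by
    unfold Summit.Ventures.CertifiedManyBodySolver.M3EnergyLowerRow
    exact energy_ge_of_sparseWindowCert hP hW⟩

/-- THE SKELETON THEOREM: the crux `LowerEdge_ge_m83o100` BY NAME from the two registered stubs
(`stub_psdCheck_sound`, `stub_replayableBlocks626_m83o100`); no other `sorry` in its cone. -/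
theorem LowerEdge_ge_m83o100_of :
    Summit.Ventures.CertifiedManyBodySolver.Theses.M3x2EdgeSplit.LowerEdge_ge_m83o100 := by
  unfold Summit.Ventures.CertifiedManyBodySolver.Theses.M3x2EdgeSplit.LowerEdge_ge_m83o100
  exact lowerEdge_m83o100_of_P_W (fun S h => stub_psdCheck_sound S h) stub_replayableBlocks626_m83o100

end

end Summit.Ventures.CertifiedManyBodySolver.Cruxes.LowerEdge_ge_m83o100.ReplayableCliqueBlocks
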